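import Literature.Computability.AlgebraicComplexity.BorderRankExtension
import Literature.Computability.AlgebraicComplexity.BorderSubstitutionTorus
import HarnessLib

/-!
# One-step unrestriction by a torus weight vector (fixed unrestriction, torus case, algebraically)

Topic `Literature/Computability/AlgebraicComplexity`.  Theorems plus two data definitions
(`weightTrunc`, `weightPart`).  Sequel to `BorderRankExtension.lean` (lemma (E1): if the slices
`t(a,·,·)` of `t ∈ K^{ι × κ × μ}` span a space `t(A^*)` of dimension `< bR(t)`, some
`Z ∉ t(A^*)` has `bR(t + e_new ⊗ Z) ≤ bR(t)`).  Here `t` is in addition HOMOGENEOUS for a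
one-parameter subgroup of the torus: there are coordinate weights `ωA, ωB, ωC ∈ ℕ` and `e₀` with
`t_{abc} ≠ 0 ⇒ ωA a + ωB b + ωC c = e₀`.  Then the new slice can be taken to be a WEIGHT VECTOR:

* `IsApproxDecomposition.torus_weightTrunc` — the engine (a variant of
  `IsApproxDecomposition.torus`, Landsberg–Michałek 2018, Lemma 2.2 inside `K[ε]`): if every
  non-zero entry of `t` has weight `≥ e`, substituting `ε = δ^q` (`q > e`) in an order-`h`
  approximate decomposition and multiplying the coordinates by `δ^ω` gives an order-`qh + e`
  approximate decomposition of the weight-`e` truncation `weightTrunc … e t` (entries of weight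
  `> e` become part of the error term).  Hence `bR(weightTrunc e t) ≤ bR(t)`
  (`algBorderRank_weightTrunc_le`).
* `algBorderRank_extendSlice_weightPart_le` — for homogeneous `t` and any `Z`, if `m` is `≤` the
  weight `ωB b + ωC c` of every non-zero entry of `Z`, then
  `bR(t + e_new ⊗ Z^{(m)}) ≤ bR(t + e_new ⊗ Z)`, `Z^{(m)} = weightPart m Z` the weight-`m` part
  (give the new index the weight `e₀` after shifting `ωA` by `m`, and truncate).
* `weightPart_mem_sliceSpan` — `t(A^*)` is a graded subspace of `K^{κ × μ}`.
* `exists_weight_extendSlice_of_finrank_sliceSpan_lt` — **(E1-torus)**: if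
  `dim t(A^*) < bR(t)` then some `Z ∉ t(A^*)` HOMOGENEOUS of some weight `m`
  (`Z_{bc} ≠ 0 ⇒ ωB b + ωC c = m`) has `bR(t + e_new ⊗ Z) ≤ bR(t)`: take the `Z₀` of (E1), discard
  its weight components lying in `t(A^*)` (this does not increase `bR`, `BorderRankExtension`'s
  `algBorderRank_extendSlice_congr_le`), and pass to the lowest remaining component by the previous
  item.
* `lt_algBorderRank_of_forall_weight_extendSlice` (`…_of_card_lt_…`) — the contrapositive used by
  certificates: if `dim t(A^*) < r ≤ bR(t)` (resp. `|ι| < r ≤ bR(t)`) and EVERY homogeneous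
  `Z ∉ t(A^*)` gives `bR(t + e_new ⊗ Z) > r`, then `bR(t) > r`.  Only the finitely many weight
  classes have to be examined, and inside a class only `Z` modulo `t(A^*)` and scalars
  (`lt_algBorderRank_extendSlice_of_eq_smul_add`).

This is the one-step, torus (one-parameter subgroup) case of the *fixed unrestriction theorem* of
Jagiełła–Jelisiejew (2026, Thm. 1.8: `bR(T) ≤ r` iff a Borel-fixed unrestriction of `T` in the
concise secant variety exists; proved there with the Borel fixed point theorem), in the explicit
`K[ε]`-language of the tree's `algBorderRank` (Bläser 2013, Def. 6.1) and over an ARBITRARY field: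
no algebraic group theory, no closedness of `{bR ≤ r}` is used — the limit along the one-parameter
subgroup is replaced by the substitution `ε = δ^q` of Landsberg–Michałek's Lemma 2.2.  Weights are
typed `ℕ` (shift integer weights by a constant; a generic one-parameter subgroup of the stabilising
torus separates the same coordinate pairs as the whole torus, so nothing is lost for finite
formats).

## References

* J. Jagiełła, J. Jelisiejew, *Concise secant varieties and unrestrictions* (2026),
  arXiv:2604.24879 — Thm. 1.8 (fixed unrestriction theorem), Thm. 2.2, Lemma 2.7.
  [JagiellaJelisiejew2026Unrestrictions]
* J. M. Landsberg, M. Michałek, *A `2n² − log₂(n) − 1` lower bound for the border rank of matrix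
  multiplication*, IMRN 2018, arXiv:1608.07486 — Lemma 2.2 (torus limits). [LandsbergMichalek2018]
* M. Bläser, *Fast Matrix Multiplication*, Theory of Computing Graduate Surveys 5 (2013), Def. 6.1.
  [Blaser2013]
-/

noncomputable section

open scoped BigOperators Polynomial

open Polynomial

namespace Literature.Computability.AlgebraicComplexity

universe u v₁ v₂ v₃

/-! ## Weight truncation of a tensor and the torus limit inside `K[ε]` -/

section Trunc

variable {K : Type u} [Field K] {ι : Type v₁} {κ : Type v₂} {μ : Type v₃}

/-- The weight-`e` truncation of `t` for coordinate weights `ωA, ωB, ωC`: keep the entries `t_{abc}`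
with `ωA a + ωB b + ωC c = e`, zero the others (the limit `lim_{δ→0} δ^{-e} (δ^ω · t)` when all
weights of the support are `≥ e`). [cite: LandsbergMichalek2018, Lemma 2.2] -/
def weightTrunc (ωA : ι → ℕ) (ωB : κ → ℕ) (ωC : μ → ℕ) (e : ℕ) (t : ι → κ → μ → K) :
    ι → κ → μ → K :=
  fun a b c => if ωA a + ωB b + ωC c = e then t a b c else 0

/-- **Torus limit inside `K[ε]`, truncating version** (cf. `IsApproxDecomposition.torus`, the case
of a homogeneous `t`): if every non-zero entry of `t` has weight `≥ e`, then substituting `ε = δ^q`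
with `q > e` in an order-`h` approximate decomposition of `t` and multiplying the coordinates by
`δ^{ωA}, δ^{ωB}, δ^{ωC}` gives an order-`qh + e` approximate decomposition of the weight-`e`
truncation of `t` (an entry of weight `W` contributes `δ^{W + qh} Q(δ^q)`, which is
`δ^{qh+e} · (unit part)` exactly when `W = e` and of higher order when `W > e`; zero entries
contribute `O(δ^{W + qh + q}) ⊆ O(δ^{qh + e + 1})`). [cite: LandsbergMichalek2018, Lemma 2.2] -/
theorem IsApproxDecomposition.torus_weightTrunc {h : ℕ} {t : ι → κ → μ → K} {r : ℕ}
    {u : Fin r → ι → K[X]} {v : Fin r → κ → K[X]} {w : Fin r → μ → K[X]}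
    (H : IsApproxDecomposition h t u v w) (ωA : ι → ℕ) (ωB : κ → ℕ) (ωC : μ → ℕ) (e : ℕ)
    (hge : ∀ a b c, t a b c ≠ 0 → e ≤ ωA a + ωB b + ωC c) (q : ℕ) (hq : e < q) :
    IsApproxDecomposition (q * h + e) (weightTrunc ωA ωB ωC e t)
      (fun ρ a => X ^ ωA a * (u ρ a).comp (X ^ q))
      (fun ρ b => X ^ ωB b * (v ρ b).comp (X ^ q))
      (fun ρ c => X ^ ωC c * (w ρ c).comp (X ^ q)) := by
  rw [isApproxDecomposition_iff] at H ⊢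
  intro a b c
  obtain ⟨Q, hQ, hQ0⟩ := H a b c
  have hsum : (∑ ρ, X ^ ωA a * (u ρ a).comp (X ^ q) * (X ^ ωB b * (v ρ b).comp (X ^ q)) *
      (X ^ ωC c * (w ρ c).comp (X ^ q))) =
      X ^ (ωA a + ωB b + ωC c) * (X ^ (q * h) * Q.comp (X ^ q)) := by
    have hc : (∑ ρ, u ρ a * v ρ b * w ρ c).comp (X ^ q) = X ^ (q * h) * Q.comp (X ^ q) := by
      rw [hQ, mul_comp, X_pow_comp, ← pow_mul]
    rw [← hc, ← coe_compRingHom_apply, map_sum, Finset.mul_sum]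
    refine Finset.sum_congr rfl fun ρ _ => ?_
    rw [map_mul, map_mul, coe_compRingHom_apply, coe_compRingHom_apply, coe_compRingHom_apply,
      pow_add, pow_add]
    ring
  rw [hsum]
  by_cases ht : t a b c = 0
  · -- `Q = X * Q₁`, and the whole term is `O(δ^{qh+q})`
    have hX : X ∣ Q := X_dvd_iff.2 (by rw [hQ0, ht])
    obtain ⟨Q₁, rfl⟩ := hX
    refine ⟨X ^ (ωA a + ωB b + ωC c + q - e) * Q₁.comp (X ^ q), ?_, ?_⟩
    · rw [mul_comp, X_comp]
      have hexp : ωA a + ωB b + ωC c + q * h + q =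
          (q * h + e) + (ωA a + ωB b + ωC c + q - e) := by omega
      calc X ^ (ωA a + ωB b + ωC c) * (X ^ (q * h) * (X ^ q * Q₁.comp (X ^ q)))
          = X ^ (ωA a + ωB b + ωC c + q * h + q) * Q₁.comp (X ^ q) := by
            rw [pow_add, pow_add]; ring
        _ = X ^ ((q * h + e) + (ωA a + ωB b + ωC c + q - e)) * Q₁.comp (X ^ q) := by rw [hexp]
        _ = X ^ (q * h + e) * (X ^ (ωA a + ωB b + ωC c + q - e) * Q₁.comp (X ^ q)) := by
            rw [pow_add]; ring
    · have hne : ¬ (ωA a + ωB b + ωC c + q - e ≤ 0) := by omega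
      rw [coeff_X_pow_mul', if_neg hne]
      simp [weightTrunc, ht]
  · have hW := hge a b c ht
    refine ⟨X ^ (ωA a + ωB b + ωC c - e) * Q.comp (X ^ q), ?_, ?_⟩
    · have hexp : ωA a + ωB b + ωC c + q * h = (q * h + e) + (ωA a + ωB b + ωC c - e) := by omega
      calc X ^ (ωA a + ωB b + ωC c) * (X ^ (q * h) * Q.comp (X ^ q))
          = X ^ (ωA a + ωB b + ωC c + q * h) * Q.comp (X ^ q) := by rw [pow_add]; ring
        _ = X ^ ((q * h + e) + (ωA a + ωB b + ωC c - e)) * Q.comp (X ^ q) := by rw [hexp]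
        _ = X ^ (q * h + e) * (X ^ (ωA a + ωB b + ωC c - e) * Q.comp (X ^ q)) := by
            rw [pow_add]; ring
    · have hq0 : q ≠ 0 := by omega
      have hQc : (Q.comp (X ^ q)).coeff 0 = t a b c := by
        rw [coeff_zero_eq_eval_zero, eval_comp, eval_pow, eval_X, zero_pow hq0,
          ← coeff_zero_eq_eval_zero, hQ0]
      rw [coeff_X_pow_mul']
      by_cases hWe : ωA a + ωB b + ωC c = e
      · rw [if_pos (by omega)]
        simp [weightTrunc, hWe, hQc]
      · rw [if_neg (by omega)]
        simp [weightTrunc, hWe]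

/-- **Weight truncation does not increase the border rank**: if every non-zero entry of `t` has
weight `≥ e` for coordinate weights `ωA, ωB, ωC ∈ ℕ`, then `bR(weightTrunc e t) ≤ bR(t)` (the
truncation is the torus limit `lim δ^{-e} (δ^ω · t)`, performed inside `K[ε]`).
[cite: LandsbergMichalek2018, Lemma 2.2] -/
theorem algBorderRank_weightTrunc_le [Fintype ι] [Fintype κ] [Fintype μ] [DecidableEq ι]
    [DecidableEq κ] [DecidableEq μ] (t : ι → κ → μ → K) (ωA : ι → ℕ) (ωB : κ → ℕ) (ωC : μ → ℕ)
    (e : ℕ) (hge : ∀ a b c, t a b c ≠ 0 → e ≤ ωA a + ωB b + ωC c) :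
    algBorderRank (weightTrunc ωA ωB ωC e t) ≤ algBorderRank t := by
  obtain ⟨h, hh⟩ := exists_algBorderRank_eq_approxRank t
  obtain ⟨u, v, w, hd⟩ := exists_isApproxDecomposition_approxRank h t
  have hd' := hd.torus_weightTrunc ωA ωB ωC e hge (e + 1) (Nat.lt_succ_self e)
  calc algBorderRank (weightTrunc ωA ωB ωC e t)
      ≤ approxRank ((e + 1) * h + e) (weightTrunc ωA ωB ωC e t) := algBorderRank_le_approxRank _ _
    _ ≤ approxRank h t := approxRank_le_of_isApproxDecomposition hd'
    _ = algBorderRank t := hh.symm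

end Trunc

/-! ## Weight components of slices and the graded slice space -/

section Ext

variable {K : Type u} [Field K] {ι : Type v₁} {κ : Type v₂} {μ : Type v₃}

/-- The weight-`m` component `Z^{(m)}` of a matrix `Z ∈ K^{κ × μ}` for the pair weight
`(b, c) ↦ ωB b + ωC c`: keep the entries of weight `m`, zero the others. [folklore] -/
def weightPart (ωB : κ → ℕ) (ωC : μ → ℕ) (m : ℕ) (Z : κ → μ → K) : κ → μ → K :=
  fun b c => if ωB b + ωC c = m then Z b c else 0

/-- Entries of `weightPart`. [folklore] -/
@[simp] theorem weightPart_apply (ωB : κ → ℕ) (ωC : μ → ℕ) (m : ℕ) (Z : κ → μ → K) (b : κ)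
    (c : μ) : weightPart ωB ωC m Z b c = if ωB b + ωC c = m then Z b c else 0 := rfl

/-- `weightPart m` is additive. [folklore] -/
theorem weightPart_add (ωB : κ → ℕ) (ωC : μ → ℕ) (m : ℕ) (Z Z' : κ → μ → K) :
    weightPart ωB ωC m (Z + Z') = weightPart ωB ωC m Z + weightPart ωB ωC m Z' := by
  funext b c
  by_cases hw : ωB b + ωC c = m <;> simp [hw]

/-- `weightPart m` is homogeneous. [folklore] -/
theorem weightPart_smul (ωB : κ → ℕ) (ωC : μ → ℕ) (m : ℕ) (l : K) (Z : κ → μ → K) :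
    weightPart ωB ωC m (l • Z) = l • weightPart ωB ωC m Z := by
  funext b c
  by_cases hw : ωB b + ωC c = m <;> simp [hw]

/-- `weightPart m 0 = 0`. [folklore] -/
@[simp] theorem weightPart_zero (ωB : κ → ℕ) (ωC : μ → ℕ) (m : ℕ) :
    weightPart ωB ωC m (0 : κ → μ → K) = 0 := by
  funext b c; simp

/-- `weightPart m` of a finite sum. [folklore] -/
theorem weightPart_sum {α : Type*} (ωB : κ → ℕ) (ωC : μ → ℕ) (m : ℕ) (s : Finset α)
    (Z : α → κ → μ → K) :
    weightPart ωB ωC m (∑ x ∈ s, Z x) = ∑ x ∈ s, weightPart ωB ωC m (Z x) := by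
  classical
  induction s using Finset.induction_on with
  | empty => simp
  | insert x s hx ih => rw [Finset.sum_insert hx, Finset.sum_insert hx, weightPart_add, ih]

/-- `weightPart m Z` is homogeneous of weight `m`. [folklore] -/
theorem weightPart_ne_zero {ωB : κ → ℕ} {ωC : μ → ℕ} {m : ℕ} {Z : κ → μ → K} {b : κ} {c : μ}
    (h : weightPart ωB ωC m Z b c ≠ 0) : ωB b + ωC c = m := by
  by_contra hw
  exact h (by simp [hw])

/-- `weightPart` is idempotent: `(Z^{(m)})^{(m)} = Z^{(m)}`. [folklore] -/
theorem weightPart_weightPart (ωB : κ → ℕ) (ωC : μ → ℕ) (m : ℕ) (Z : κ → μ → K) :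
    weightPart ωB ωC m (weightPart ωB ωC m Z) = weightPart ωB ωC m Z := by
  funext b c
  by_cases hw : ωB b + ωC c = m <;> simp [hw]

/-- A slice `t(a,·,·)` of a homogeneous tensor is homogeneous: its weight-`m` part is the slice
itself (if `ωA a + m = e₀`) or zero. [folklore] -/
theorem weightPart_slice_eq {t : ι → κ → μ → K} {ωA : ι → ℕ} {ωB : κ → ℕ} {ωC : μ → ℕ} {e₀ : ℕ}
    (hhom : ∀ a b c, t a b c ≠ 0 → ωA a + ωB b + ωC c = e₀) (m : ℕ) (a : ι) :
    weightPart ωB ωC m (t a) = if ωA a + m = e₀ then t a else 0 := by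
  funext b c
  by_cases ht : t a b c = 0
  · by_cases hm : ωA a + m = e₀ <;> simp [hm, ht]
  · have hw := hhom a b c ht
    by_cases hm : ωA a + m = e₀
    · rw [if_pos hm, weightPart_apply, if_pos (by omega)]
    · rw [if_neg hm, weightPart_apply, if_neg (by omega)]
      rfl

/-- **The slice space of a homogeneous tensor is graded**: `Z ∈ t(A^*) ⇒ Z^{(m)} ∈ t(A^*)`.
[folklore] -/
theorem weightPart_mem_sliceSpan {t : ι → κ → μ → K} {ωA : ι → ℕ} {ωB : κ → ℕ} {ωC : μ → ℕ}
    {e₀ : ℕ} (hhom : ∀ a b c, t a b c ≠ 0 → ωA a + ωB b + ωC c = e₀) (m : ℕ) {Z : κ → μ → K}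
    (hZ : Z ∈ sliceSpan t) : weightPart ωB ωC m Z ∈ sliceSpan t := by
  induction hZ using Submodule.span_induction with
  | mem x hx =>
    obtain ⟨a, rfl⟩ := hx
    rw [weightPart_slice_eq hhom m a]
    by_cases hm : ωA a + m = e₀
    · rw [if_pos hm]; exact Submodule.subset_span ⟨a, rfl⟩
    · rw [if_neg hm]; exact Submodule.zero_mem _
  | zero => rw [weightPart_zero]; exact Submodule.zero_mem _
  | add x y _ _ hx hy => rw [weightPart_add]; exact Submodule.add_mem _ hx hy
  | smul l x _ hx => rw [weightPart_smul]; exact Submodule.smul_mem _ l hx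

/-- A matrix is the sum of its weight components over any finite set of weights containing the
weights of all coordinate pairs. [folklore] -/
theorem sum_weightPart_eq (ωB : κ → ℕ) (ωC : μ → ℕ) (S : Finset ℕ)
    (hS : ∀ b c, ωB b + ωC c ∈ S) (Z : κ → μ → K) : ∑ m ∈ S, weightPart ωB ωC m Z = Z := by
  funext b c
  rw [Finset.sum_apply, Finset.sum_apply]
  simp only [weightPart_apply]
  rw [Finset.sum_ite_eq S (ωB b + ωC c) (fun _ => Z b c), if_pos (hS b c)]

/-- Entries of a sum of distinct weight components: `(∑_{m ∈ S} Z^{(m)})_{bc} = Z_{bc}` if the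
weight of `(b,c)` lies in `S`, else `0`. [folklore] -/
theorem sum_weightPart_apply (ωB : κ → ℕ) (ωC : μ → ℕ) (S : Finset ℕ) (Z : κ → μ → K) (b : κ)
    (c : μ) : (∑ m ∈ S, weightPart ωB ωC m Z) b c = if ωB b + ωC c ∈ S then Z b c else 0 := by
  rw [Finset.sum_apply, Finset.sum_apply]
  simp only [weightPart_apply]
  rw [Finset.sum_ite_eq S (ωB b + ωC c) (fun _ => Z b c)]

variable [Fintype ι] [Fintype κ] [Fintype μ] [DecidableEq ι] [DecidableEq κ] [DecidableEq μ]

/-! ## Passing to the lowest weight component of the new slice -/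

/-- **Torus limit of an extension**: let `t` be homogeneous of weight `e₀`
(`t_{abc} ≠ 0 ⇒ ωA a + ωB b + ωC c = e₀`) and let `m ≤ ωB b + ωC c` for every non-zero entry
`Z_{bc}` of the new slice.  Then `bR(t + e_new ⊗ Z^{(m)}) ≤ bR(t + e_new ⊗ Z)`: give the new index
the weight `e₀` and the old first-factor indices the weights `ωA a + m`; then every non-zero entry
of `t + e_new ⊗ Z` has weight `≥ e₀ + m`, and its weight-`(e₀ + m)` truncation is
`t + e_new ⊗ Z^{(m)}`. [cite: JagiellaJelisiejew2026Unrestrictions, Thm. 1.8] -/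
theorem algBorderRank_extendSlice_weightPart_le (t : ι → κ → μ → K) {ωA : ι → ℕ} {ωB : κ → ℕ}
    {ωC : μ → ℕ} {e₀ : ℕ} (hhom : ∀ a b c, t a b c ≠ 0 → ωA a + ωB b + ωC c = e₀)
    (Z : κ → μ → K) (m : ℕ) (hm : ∀ b c, Z b c ≠ 0 → m ≤ ωB b + ωC c) :
    algBorderRank (extendSlice t (weightPart ωB ωC m Z)) ≤ algBorderRank (extendSlice t Z) := by
  let ωA' : Option ι → ℕ := fun a' => a'.elim e₀ fun a => ωA a + m
  have hge : ∀ a' b c, extendSlice t Z a' b c ≠ 0 → e₀ + m ≤ ωA' a' + ωB b + ωC c := by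
    rintro (_ | a) b c hne
    · have := hm b c (by simpa using hne)
      change e₀ + m ≤ e₀ + ωB b + ωC c
      omega
    · have := hhom a b c (by simpa using hne)
      change e₀ + m ≤ ωA a + m + ωB b + ωC c
      omega
  have heq : weightTrunc ωA' ωB ωC (e₀ + m) (extendSlice t Z) =
      extendSlice t (weightPart ωB ωC m Z) := by
    funext a' b c
    rcases a' with _ | a
    · simp only [weightTrunc, extendSlice_none, weightPart_apply]
      change (if e₀ + ωB b + ωC c = e₀ + m then Z b c else 0) = _
      by_cases hw : ωB b + ωC c = m
      · rw [if_pos (by omega), if_pos hw]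
      · rw [if_neg (by omega), if_neg hw]
    · simp only [weightTrunc, extendSlice_some]
      change (if ωA a + m + ωB b + ωC c = e₀ + m then t a b c else 0) = _
      by_cases ht : t a b c = 0
      · simp [ht]
      · rw [if_pos (by have := hhom a b c ht; omega)]
  rw [← heq]
  exact algBorderRank_weightTrunc_le _ ωA' ωB ωC (e₀ + m) hge

/-! ## (E1-torus): a homogeneous new slice preserving the border rank exists -/

/-- **One-step unrestriction by a weight vector.** Let `t ∈ K^{ι × κ × μ}` be homogeneous of
weight `e₀` for coordinate weights `ωA, ωB, ωC ∈ ℕ`, with slice space `t(A^*)` of dimension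
`< bR(t)`.  Then some `Z ∉ t(A^*)` which is HOMOGENEOUS (`Z_{bc} ≠ 0 ⇒ ωB b + ωC c = m` for one
weight `m`) satisfies `bR(t + e_new ⊗ Z) ≤ bR(t)`.  Any field.  (Jagiełła–Jelisiejew's fixed
unrestriction theorem, Thm. 1.8, in the one-step torus case, with the Borel fixed point theorem
replaced by lemma (E1) and the torus limit inside `K[ε]`: discard the weight components of the `Z₀`
of (E1) that lie in `t(A^*)`, then keep the lowest remaining one.)
[cite: JagiellaJelisiejew2026Unrestrictions, Thm. 1.8] -/
theorem exists_weight_extendSlice_of_finrank_sliceSpan_lt (t : ι → κ → μ → K) {ωA : ι → ℕ}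
    {ωB : κ → ℕ} {ωC : μ → ℕ} {e₀ : ℕ} (hhom : ∀ a b c, t a b c ≠ 0 → ωA a + ωB b + ωC c = e₀)
    (ht : Module.finrank K (sliceSpan t) < algBorderRank t) :
    ∃ (m : ℕ) (Z : κ → μ → K), (∀ b c, Z b c ≠ 0 → ωB b + ωC c = m) ∧ Z ∉ sliceSpan t ∧
      algBorderRank (extendSlice t Z) ≤ algBorderRank t := by
  classical
  obtain ⟨Z₀, hZ₀V, hZ₀⟩ := exists_extendSlice_of_finrank_sliceSpan_lt t ht
  -- the weights of all coordinate pairs, and the "bad" ones (component not in `t(A^*)`)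
  let S : Finset ℕ := Finset.univ.image fun bc : κ × μ => ωB bc.1 + ωC bc.2
  have hS : ∀ b c, ωB b + ωC c ∈ S := fun b c =>
    Finset.mem_image.2 ⟨(b, c), Finset.mem_univ _, rfl⟩
  let Bad : Finset ℕ := S.filter fun m => weightPart ωB ωC m Z₀ ∉ sliceSpan t
  have hBad : Bad.Nonempty := by
    by_contra hemp
    rw [Finset.not_nonempty_iff_eq_empty, Finset.filter_eq_empty_iff] at hemp
    apply hZ₀V
    rw [← sum_weightPart_eq ωB ωC S hS Z₀]
    exact Submodule.sum_mem _ fun m hm => not_not.1 (hemp hm)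
  -- `Z₁` = the sum of the bad components; `Z₁ - Z₀ ∈ t(A^*)`
  let Z₁ : κ → μ → K := ∑ m ∈ Bad, weightPart ωB ωC m Z₀
  have hdiff : Z₁ - Z₀ ∈ sliceSpan t := by
    have hsplit : Z₀ = Z₁ + ∑ m ∈ S.filter (fun m => ¬ weightPart ωB ωC m Z₀ ∉ sliceSpan t),
        weightPart ωB ωC m Z₀ := by
      rw [Finset.sum_filter_add_sum_filter_not, sum_weightPart_eq ωB ωC S hS Z₀]
    have hgood : (∑ m ∈ S.filter (fun m => ¬ weightPart ωB ωC m Z₀ ∉ sliceSpan t),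
        weightPart ωB ωC m Z₀) ∈ sliceSpan t :=
      Submodule.sum_mem _ fun m hm => not_not.1 (Finset.mem_filter.1 hm).2
    have : Z₁ - Z₀ = -(∑ m ∈ S.filter (fun m => ¬ weightPart ωB ωC m Z₀ ∉ sliceSpan t),
        weightPart ωB ωC m Z₀) := by
      conv_lhs => rw [hsplit]
      abel
    rw [this]
    exact Submodule.neg_mem _ hgood
  obtain ⟨c, hc⟩ := (Submodule.mem_span_range_iff_exists_fun K).1 hdiff
  have hZ₁eq : Z₁ = (1 : K) • Z₀ + ∑ a, c a • t a := by rw [hc, one_smul]; abel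
  have hZ₁le : algBorderRank (extendSlice t Z₁) ≤ algBorderRank (extendSlice t Z₀) := by
    rw [hZ₁eq]; exact algBorderRank_extendSlice_congr_le t Z₀ c 1
  -- the lowest bad weight
  let m₁ := Bad.min' hBad
  have hm₁ : m₁ ∈ Bad := Finset.min'_mem Bad hBad
  have hsupp : ∀ b d, Z₁ b d ≠ 0 → m₁ ≤ ωB b + ωC d := by
    intro b d hne
    have happ := sum_weightPart_apply ωB ωC Bad Z₀ b d
    by_cases hw : ωB b + ωC d ∈ Bad
    · exact Finset.min'_le Bad _ hw
    · exact absurd (by rw [show Z₁ b d = _ from happ, if_neg hw]) hne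
  have hpart : weightPart ωB ωC m₁ Z₁ = weightPart ωB ωC m₁ Z₀ := by
    funext b d
    simp only [weightPart_apply]
    by_cases hw : ωB b + ωC d = m₁
    · rw [if_pos hw, if_pos hw, show Z₁ b d = _ from sum_weightPart_apply ωB ωC Bad Z₀ b d,
        if_pos (hw ▸ hm₁)]
    · rw [if_neg hw, if_neg hw]
  refine ⟨m₁, weightPart ωB ωC m₁ Z₀, fun b d h => weightPart_ne_zero h,
    (Finset.mem_filter.1 hm₁).2, ?_⟩
  rw [← hpart]
  exact ((algBorderRank_extendSlice_weightPart_le t hhom Z₁ m₁ hsupp).trans hZ₁le).trans hZ₀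

/-- **Weight-class extension search (contrapositive).** If `t` is homogeneous,
`dim t(A^*) < r ≤ bR(t)`, and every HOMOGENEOUS `Z ∉ t(A^*)` gives `bR(t + e_new ⊗ Z) > r`, then
`bR(t) > r`. [cite: JagiellaJelisiejew2026Unrestrictions, Thm. 1.8] -/
theorem lt_algBorderRank_of_forall_weight_extendSlice (t : ι → κ → μ → K) {ωA : ι → ℕ}
    {ωB : κ → ℕ} {ωC : μ → ℕ} {e₀ : ℕ} (hhom : ∀ a b c, t a b c ≠ 0 → ωA a + ωB b + ωC c = e₀)
    {r : ℕ} (hVr : Module.finrank K (sliceSpan t) < r) (hr : r ≤ algBorderRank t)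
    (H : ∀ (m : ℕ) (Z : κ → μ → K), (∀ b c, Z b c ≠ 0 → ωB b + ωC c = m) → Z ∉ sliceSpan t →
      r < algBorderRank (extendSlice t Z)) :
    r < algBorderRank t := by
  refine lt_of_le_of_ne hr fun hrt => ?_
  obtain ⟨m, Z, hZm, hZV, hle⟩ :=
    exists_weight_extendSlice_of_finrank_sliceSpan_lt t hhom (hVr.trans_le hr)
  exact (H m Z hZm hZV).not_ge (hle.trans hrt.symm.le)

/-- The same with the slice-count hypothesis `|ι| < r`.
[cite: JagiellaJelisiejew2026Unrestrictions, Thm. 1.8] -/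
theorem lt_algBorderRank_of_card_lt_of_forall_weight_extendSlice (t : ι → κ → μ → K)
    {ωA : ι → ℕ} {ωB : κ → ℕ} {ωC : μ → ℕ} {e₀ : ℕ}
    (hhom : ∀ a b c, t a b c ≠ 0 → ωA a + ωB b + ωC c = e₀) {r : ℕ}
    (hcard : Fintype.card ι < r) (hr : r ≤ algBorderRank t)
    (H : ∀ (m : ℕ) (Z : κ → μ → K), (∀ b c, Z b c ≠ 0 → ωB b + ωC c = m) → Z ∉ sliceSpan t →
      r < algBorderRank (extendSlice t Z)) :
    r < algBorderRank t :=
  lt_algBorderRank_of_forall_weight_extendSlice t hhom ((finrank_range_le_card t).trans_lt hcard)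
    hr H

/-! ## Inside a weight class only the line of `Z` modulo `t(A^*)` matters -/

/-- If `Z = l z + ∑ c_a t_a` with `Z ∉ t(A^*)` (so `l ≠ 0`), then
`bR(t + e_new ⊗ Z) = bR(t + e_new ⊗ z)`; in particular a lower bound `bR(t + e_new ⊗ z) > r` for ONE
representative `z` of a weight class that is one-dimensional modulo `t(A^*)` covers the whole class.
[folklore] -/
theorem lt_algBorderRank_extendSlice_of_eq_smul_add (t : ι → κ → μ → K) {z Z : κ → μ → K}
    {r : ℕ} (hz : r < algBorderRank (extendSlice t z)) {l : K} {c : ι → K}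
    (hZ : Z = l • z + ∑ a, c a • t a) (hZV : Z ∉ sliceSpan t) :
    r < algBorderRank (extendSlice t Z) := by
  have hl : l ≠ 0 := by
    rintro rfl
    apply hZV
    rw [hZ, zero_smul, zero_add]
    exact Submodule.sum_mem _ fun a _ => Submodule.smul_mem _ _ (Submodule.subset_span ⟨a, rfl⟩)
  rw [hZ, algBorderRank_extendSlice_congr t z c hl]
  exact hz

end Ext

end Literature.Computability.AlgebraicComplexity

end
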